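import Mathlib.LinearAlgebra.Dual.Lemmas
import Mathlib.LinearAlgebra.Quotient.Card
import Mathlib.Algebra.Module.ZMod
import Mathlib.Algebra.Field.ZMod
import Mathlib.RingTheory.Finiteness.Cardinality
import HarnessLib

/-!
# The prime-choice covering lemma: `n ≤ p` affine conditions mod `p` never exhaust a group
# (cell `b2b-bsdres`, team n1011, row T-C55K, file 1/5 — PURE ALGEBRA; seat p15)

HONEST FRAMING (cell `b2b-bsdres`, run/shared/lean/b2b/bsd-rank1-residual/, verbatim in every
file): the goal of the cell is to DELETE the COMBINATION-SHAPED residual classes of the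
Birch–Swinnerton-Dyer formula for ALL analytic-rank `≤ 1` elliptic curves over `ℚ` — "full BSD
formula for every rank `≤ 1` curve in class `C`" assembled STRICTLY from published theorems — so
that the rank-`≤ 1` remainder becomes exactly the CONSTRUCTION-SHAPED classes, which are TYPED
(missing-input `Prop`s), NOT attempted. This is not "finishing BSD". Team n1011 (N10/N11, the
additive block `X4 ∧ p = 3`): research route; TOOL theorems of linear algebra over a finite field,
no class theorem, nothing booked, no mark changed; no definition, no named fact.

## What and why

Row T-C55K proves Sakamoto's prime-choice lemma at `p = 3` (JTNB 36 (2024), Lemma 5.2 / Cor. 5.5;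
= Mazur–Rubin, *Kolyvagin systems*, Prop. 3.6.1 with the hypothesis (H.4b) `p > 4` removed) as a
theorem of the tree, discharging the binder `hC55` / `hprime` of the cell's R1-16 files.  The ONLY
place where `p` enters Mazur–Rubin's proof is the count "`μ(H_i) ≤ 1/p`, so four cosets have total
measure `4/p < 1`" (Mem. AMS 799, p. 31); at `p = 3` with three classes Sakamoto replaces it by the
observation that the three cosets in question cannot cover.  This file is that observation, in the
abstract form the cocycle argument (file 2, `PrimeChoiceSelection`) consumes:

* `exists_dual_forall_apply_ne_zero` — over a finite field `k` with `q` elements, any `n ≤ q`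
  NON-ZERO vectors of a finite-dimensional `k`-space admit ONE linear functional that vanishes on
  none of them (count in the finite dual space `V*`: the `n` hyperplanes `{β | β vᵢ = 0}` have
  `|V*|/q` elements each and share `0`, so they cover at most `n(|V*|/q − 1) + 1 < |V*|` points).
* `exists_forall_apply_add_ne_zero` — the SELECTION LEMMA: for a group `G`, linear data
  `F : 𝔽_pⁿ → (G → 𝔽_p)` (each `F a` a homomorphism on `G`) and `Λ : 𝔽_pⁿ → 𝔽_p` with
  `F a = 0 → Λ a = 0`, and `F eᵢ ≠ 0` for the `n ≤ p` coordinate vectors, some `g ∈ G` has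
  `F eᵢ g + Λ eᵢ ≠ 0` for every `i` (pass to `V = 𝔽_pⁿ / ker F`; the evaluations `g ↦ (v ↦ F v g)`
  fill the dual space `V*` — a subgroup of `V*` whose common zero locus is `0` is everything,
  `Subspace.dualCoannihilator_dualAnnihilator_eq` — so the affine functional `Λ` is absorbed and the
  first lemma applies).  In file 2, `G = Gal(K̄/K(T̄, μ_N))`, `F eᵢ = (restriction of the cocycle
  `cᵢ`) mod `(τ − 1)T̄`, `Λ eᵢ = cᵢ(τ) mod (τ − 1)T̄`.

References: B. Mazur, K. Rubin, *Kolyvagin systems*, Mem. AMS 799 (2004), Prop. 3.6.1 (p. 30–31);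
R. Sakamoto, *The theory of Kolyvagin systems for p = 3*, JTNB 36 (2024), Lemma 5.2, Cor. 5.5
(pp. 928–930); R. Sakamoto, arXiv:2106.03370v2, App. §5, Lemma 5.1.
-/

namespace Summit.BirchSwinnertonDyer.Rank1Residual.GaloisImage.PrimeChoice

open Function Module

/-! ## (A) `n ≤ |k|` non-zero vectors have a common non-vanishing functional -/

section Covering

variable {k : Type*} [Field k] [Finite k] {V : Type*} [AddCommGroup V] [Module k V]
  [Module.Finite k V]

/-- **Over a finite field `k`, `n ≤ |k|` non-zero vectors of a finite-dimensional `k`-space admit a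
linear functional vanishing on none of them** (equivalently: `V*` is not the union of `n ≤ |k|`
hyperplanes).  Counting: each hyperplane `{β | β vᵢ = 0}` has `|V*|/|k|` elements and contains `0`.
This is the group-theoretic content of Mazur–Rubin's "`μ(H_i) ≤ 1/p`" (Prop. 3.6.1, p. 31) in the
sharp form needed at `p = 3` with three classes (Sakamoto, arXiv:2106.03370v2 Lemma 5.1).
[cite: MazurRubin2004, Prop. 3.6.1 proof, p. 31] [cite: Sakamoto2024, Lemma 5.2 (p. 928)] -/
theorem exists_dual_forall_apply_ne_zero {ι : Type*} [Finite ι] (v : ι → V) (hv : ∀ i, v i ≠ 0)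
    (hn : Nat.card ι ≤ Nat.card k) : ∃ β : Module.Dual k V, ∀ i, β (v i) ≠ 0 := by
  classical
  haveI : Finite (Module.Dual k V) := Module.finite_of_finite k
  letI : Fintype (Module.Dual k V) := Fintype.ofFinite _
  letI : Fintype ι := Fintype.ofFinite _
  letI : Fintype k := Fintype.ofFinite _
  by_contra h
  push Not at h
  -- the evaluation functionals `e i : V* → k`, `β ↦ β (v i)`, are onto
  set e : ι → (Module.Dual k V →ₗ[k] k) := fun i => LinearMap.applyₗ (v i) with he_def
  have he : ∀ i β, e i β = β (v i) := fun i β => rfl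
  have hsurj : ∀ i, Surjective (e i) := by
    intro i t
    obtain ⟨β, hβ⟩ := Module.Projective.exists_dual_ne_zero k (hv i)
    refine ⟨(t / β (v i)) • β, ?_⟩
    rw [he, LinearMap.smul_apply, smul_eq_mul, div_mul_cancel₀ t hβ]
  -- `|V*| = |ker (e i)| · |k|`
  have hcard : ∀ i, Nat.card (Module.Dual k V) = Nat.card (LinearMap.ker (e i)) * Nat.card k := by
    intro i
    rw [Submodule.card_eq_card_quotient_mul_card (LinearMap.ker (e i))]
    congr 1
    exact Nat.card_congr (LinearMap.quotKerEquivOfSurjective (e i) (hsurj i)).toEquiv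
  set q := Nat.card k with hq_def
  set d := Nat.card (Module.Dual k V) with hd_def
  have hq2 : 2 ≤ q := by
    rw [hq_def]
    exact Finite.one_lt_card
  -- every non-zero functional lies in some punctured hyperplane
  have hsub : (Finset.univ : Finset (Module.Dual k V)).erase 0 ⊆
      Finset.univ.biUnion fun i => ((LinearMap.ker (e i) : Set (Module.Dual k V)).toFinset).erase 0 := by
    intro β hβ
    rw [Finset.mem_erase] at hβ
    obtain ⟨i, hi⟩ := h β
    rw [Finset.mem_biUnion]
    refine ⟨i, Finset.mem_univ i, ?_⟩
    rw [Finset.mem_erase, Set.mem_toFinset]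
    exact ⟨hβ.1, by rw [SetLike.mem_coe, LinearMap.mem_ker, he]; exact hi⟩
  have hle := (Finset.card_le_card hsub).trans Finset.card_biUnion_le
  rw [Finset.card_erase_of_mem (Finset.mem_univ _), Finset.card_univ, Fintype.card_eq_nat_card]
    at hle
  -- each punctured hyperplane has `d / q - 1` elements
  have hker : ∀ i, (((LinearMap.ker (e i) : Set (Module.Dual k V)).toFinset).erase 0).card =
      Nat.card (LinearMap.ker (e i)) - 1 := by
    intro i
    rw [Finset.card_erase_of_mem, Set.toFinset_card, ← Nat.card_eq_fintype_card]
    · rfl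
    · rw [Set.mem_toFinset]; exact (LinearMap.ker (e i)).zero_mem
  simp only [hker] at hle
  -- sum over `ι`: `n · (m - 1)` with `d = m q`
  have hm : ∀ i, Nat.card (LinearMap.ker (e i)) * q = d := fun i => (hcard i).symm
  obtain ⟨m, hmq⟩ : ∃ m, ∀ i, Nat.card (LinearMap.ker (e i)) = m := by
    by_cases hι : Nonempty ι
    · obtain ⟨i₀⟩ := hι
      refine ⟨Nat.card (LinearMap.ker (e i₀)), fun i => ?_⟩
      have h1 := hm i
      have h2 := hm i₀
      have hq0 : 0 < q := by omega
      exact Nat.eq_of_mul_eq_mul_right hq0 (h1.trans h2.symm)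
    · exact ⟨0, fun i => (hι ⟨i⟩).elim⟩
  simp only [hmq, Finset.sum_const, Finset.card_univ, smul_eq_mul, Fintype.card_eq_nat_card] at hle
  -- `d - 1 ≤ n (m - 1)`, `n ≤ q`, `d = m q`, `q ≥ 2`, `d ≥ 1` : contradiction
  have hd1 : 1 ≤ d := by
    rw [hd_def]; exact Nat.card_pos
  by_cases hι : Nonempty ι
  · obtain ⟨i₀⟩ := hι
    have hdm : m * q = d := by rw [← hmq i₀]; exact hm i₀
    have h1 : d - 1 ≤ q * (m - 1) := hle.trans (Nat.mul_le_mul_right _ hn)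
    have hm1 : 1 ≤ m := by
      rcases Nat.eq_zero_or_pos m with h0 | h0
      · rw [h0, zero_mul] at hdm; omega
      · exact h0
    -- `q (m - 1) = m q - q = d - q`
    have h2 : q * (m - 1) = d - q := by
      rw [Nat.mul_sub, mul_one, mul_comm, hdm]
    rw [h2] at h1
    have : q ≤ d := by rw [← hdm]; nlinarith
    omega
  · -- no vectors: `h 0` produces an index
    obtain ⟨i, -⟩ := h 0
    exact hι ⟨i⟩

end Covering

/-! ## (B) The selection lemma -/

section Selection

variable {p : ℕ} [Fact p.Prime]

/-- **The selection lemma** (abstract form of Sakamoto's Lemma 5.2 / Mazur–Rubin's Prop. 3.6.1 step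
"there is `γ ∈ G_F` with `c_i(τγ) ∉ (τγ − 1)T` for all `i`").  Let `G` be a group, `n ≤ p`,
`F : 𝔽_pⁿ →ₗ (G → 𝔽_p)` with every `F a` a homomorphism on `G`, `Λ : 𝔽_pⁿ →ₗ 𝔽_p` with
`F a = 0 → Λ a = 0`, and suppose `F eᵢ ≠ 0` for the coordinate vectors `eᵢ`.  Then some `g ∈ G`
satisfies `F eᵢ g + Λ eᵢ ≠ 0` for every `i`.  (In file 2: `F eᵢ` is the restriction of the `i`-th
cocycle to `G = Gal(K̄/K(T̄, μ_N))` read modulo `(τ − 1)T̄ ≅ 𝔽_p`, `Λ eᵢ` its value at `τ`.)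
[cite: Sakamoto2024, Lemma 5.2 (p. 928)] [cite: MazurRubin2004, Prop. 3.6.1 proof, p. 31] -/
theorem exists_forall_apply_add_ne_zero {n : ℕ} (hn : n ≤ p) {G : Type*} [Group G]
    (F : (Fin n → ZMod p) →ₗ[ZMod p] (G → ZMod p))
    (hF : ∀ a g h, F a (g * h) = F a g + F a h)
    (Λ : (Fin n → ZMod p) →ₗ[ZMod p] ZMod p) (hΛ : ∀ a, F a = 0 → Λ a = 0)
    (hne : ∀ i, F (Pi.single i 1) ≠ 0) :
    ∃ g : G, ∀ i, F (Pi.single i 1) g + Λ (Pi.single i 1) ≠ 0 := by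
  classical
  set N : Submodule (ZMod p) (Fin n → ZMod p) := LinearMap.ker F with hN_def
  -- `Λ` and `F` descend to `V = 𝔽_pⁿ / ker F`, `F` injectively
  have hNΛ : N ≤ LinearMap.ker Λ := fun a ha => by
    rw [LinearMap.mem_ker]
    exact hΛ a (by rwa [hN_def, LinearMap.mem_ker] at ha)
  set Λ' : ((Fin n → ZMod p) ⧸ N) →ₗ[ZMod p] ZMod p := N.liftQ Λ hNΛ with hΛ'_def
  set F' : ((Fin n → ZMod p) ⧸ N) →ₗ[ZMod p] (G → ZMod p) := N.liftQ F le_rfl with hF'_def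
  have hF'inj : Injective F' := by
    rw [← LinearMap.ker_eq_bot]
    exact Submodule.ker_liftQ_eq_bot _ _ _ le_rfl
  have hF'mk : ∀ a, F' (N.mkQ a) = F a := fun a => Submodule.liftQ_apply _ _ _
  have hΛ'mk : ∀ a, Λ' (N.mkQ a) = Λ a := fun a => Submodule.liftQ_apply _ _ _
  have hF'mul : ∀ x g h, F' x (g * h) = F' x g + F' x h := by
    intro x g h
    obtain ⟨a, rfl⟩ := N.mkQ_surjective x
    rw [hF'mk]
    exact hF a g h
  -- the evaluations `Φ g : v ↦ F' v g` form a subgroup `B` of the dual space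
  set Φ : G → Module.Dual (ZMod p) ((Fin n → ZMod p) ⧸ N) := fun g => (LinearMap.proj g).comp F'
    with hΦ_def
  have hΦ : ∀ g x, Φ g x = F' x g := fun g x => rfl
  have hΦmul : ∀ g h, Φ (g * h) = Φ g + Φ h := fun g h =>
    LinearMap.ext fun x => by rw [LinearMap.add_apply, hΦ, hΦ, hΦ, hF'mul]
  have hΦone : Φ 1 = 0 := by
    have h := hΦmul 1 1
    rw [mul_one] at h
    exact left_eq_add.mp h
  have hΦinv : ∀ g, Φ g⁻¹ = -Φ g := fun g => by
    have h := hΦmul g g⁻¹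
    rw [mul_inv_cancel, hΦone] at h
    exact (neg_eq_of_add_eq_zero_right h.symm).symm
  let B₀ : AddSubgroup (Module.Dual (ZMod p) ((Fin n → ZMod p) ⧸ N)) :=
    { carrier := Set.range Φ
      add_mem' := by
        rintro _ _ ⟨g, rfl⟩ ⟨h, rfl⟩
        exact ⟨g * h, hΦmul g h⟩
      zero_mem' := ⟨1, hΦone⟩
      neg_mem' := by
        rintro _ ⟨g, rfl⟩
        exact ⟨g⁻¹, hΦinv g⟩ }
  set B : Submodule (ZMod p) (Module.Dual (ZMod p) ((Fin n → ZMod p) ⧸ N)) :=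
    AddSubgroup.toZModSubmodule p B₀ with hB_def
  have hmemB : ∀ β, β ∈ B ↔ β ∈ Set.range Φ := fun β => Iff.rfl
  -- its common zero locus is `0` (injectivity of `F'`), so `B` is the whole dual space
  have hBco : B.dualCoannihilator = ⊥ := by
    rw [eq_bot_iff]
    intro x hx
    rw [Submodule.mem_dualCoannihilator] at hx
    have h0 : F' x = 0 := funext fun g => hx (Φ g) ((hmemB _).mpr ⟨g, rfl⟩)
    rw [Submodule.mem_bot]
    exact hF'inj (h0.trans (map_zero F').symm)
  have hBtop : B = ⊤ := by
    rw [← Subspace.dualCoannihilator_dualAnnihilator_eq (W := B), hBco,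
      Submodule.dualAnnihilator_bot]
  -- the coordinate vectors are non-zero in the quotient: apply (A)
  have hc : ∀ i, N.mkQ (Pi.single i 1) ≠ 0 := by
    intro i h0
    rw [Submodule.mkQ_apply, Submodule.Quotient.mk_eq_zero, hN_def, LinearMap.mem_ker] at h0
    exact hne i h0
  have hcardn : Nat.card (Fin n) ≤ Nat.card (ZMod p) := by
    rwa [Nat.card_zmod, Nat.card_eq_fintype_card, Fintype.card_fin]
  obtain ⟨β₀, hβ₀⟩ := exists_dual_forall_apply_ne_zero (k := ZMod p)
    (fun i => N.mkQ (Pi.single i 1)) hc hcardn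
  obtain ⟨g, hg⟩ : β₀ - Λ' ∈ Set.range Φ := by
    rw [← hmemB, hBtop]
    exact Submodule.mem_top
  refine ⟨g, fun i => ?_⟩
  have h1 : F (Pi.single i 1) g + Λ (Pi.single i 1) = β₀ (N.mkQ (Pi.single i 1)) := by
    rw [← hF'mk, ← hΛ'mk, ← hΦ, hg, LinearMap.sub_apply, sub_add_cancel]
  rw [h1]
  exact hβ₀ i

end Selection

end Summit.BirchSwinnertonDyer.Rank1Residual.GaloisImage.PrimeChoice
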